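import Summits.QuantumFields.YangMills.Theorems.SourcedPressureJensenSourcedPressureIncrementCovarianceFormBound
import HarnessLib

/-!
# `SourcedPressureIncrement` (stmt-QuantumFields-22517) / `ColdBoxSourcedPressure` (stmt-QuantumFields-23807), helper:
# decay-free square-summable rows of the curvature kernel, and the Loewner form `covGram ≤ 1`

Consequences of the one-orientation contraction bound
`Σⱼⱼ' cⱼ cⱼ' K((gⱼ;P),(gⱼ';P)) ≤ Σⱼⱼ' [gⱼ = gⱼ'] cⱼ cⱼ'` of
`SourcedPressureJensenSourcedPressureIncrementCovarianceFormBound.lean` (`K = curvatureTwoPoint = d(-Δ)⁻¹d*`,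
`d ≥ 3`, parallel plaquettes `(x;P)`, `(y;P)` of one coordinate plane `P = (i<j)`):

* **`sum_sq_curvatureTwoPoint_parallel_le`** — every row is square-summable with the DIAGONAL as bound, without any
  decay estimate of the Green function: `Σ_{y ∈ S} K((x;P),(y;P))² ≤ K((x;P),(x;P)) = 2/d` for every finite set `S`
  of sites (`(K²)ₓₓ ≤ Kₓₓ` from `0 ≤ K ≤ 1`; `…_le_two_div`, `(1,2)`-plane form `sum_sq_curvatureTwoPoint_plaquette12_le`);
  in particular the axis numbers `c_n = curvaturePlaquetteCorr` satisfy `Σ_{n ∈ T} c_n² ≤ 2/d` for every finite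
  `T ⊂ ℤ` (`sum_sq_curvaturePlaquetteCorr_le`; `= 1/2` in `d = 4`) — the `ℓ²` input of second cumulants of quadratic
  composites of the curvature field (`Var_γ(H_B) ≤ M₂ |B|`-type bounds) in a form uniform in the box;
* **`dotProduct_covGram_curvatureCovKernel_mulVec_le`** / **`posSemidef_one_sub_covGram_curvatureCovKernel`** — the
  coloured bound `sum_sum_curvatureCovKernel_parallel_le_sum_sq` packaged for Mathlib's matrix API:
  `xᵀ (covGram (curvatureCovKernel d D) I) x ≤ xᵀ x` and `(1 - covGram (curvatureCovKernel d D) I).PosSemidef` for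
  every finite set `I` of (plaquette, colour) indices of one orientation (with the tree's
  `isPosSemidefKernel_curvatureCovKernel`: `0 ≤ covGram ≤ 1` in the Loewner order, uniformly in `I`) — the form in
  which Gaussian exponential-moment / determinant bounds (`det(1 - 2tG)`, `E exp(t|Y|²)`) consume "uniform stability".

Route `SourcedPressureJensen`, crux `SourcedPressureIncrement` (stub `stub_gauss`) and its cold-box child
`ColdBoxSourcedPressure`; also usable by `EntropyBudgetEquipartition` / `EquipartitionCriticality` / `ColdBoxAllGroups`.
No route file is imported.  Everything is proved; no definition, no named fact.  RECORD-label rung support; the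
Yang–Mills mass gap is NOT proved by anything here. [folklore]
-/

noncomputable section

open Finset Real
open scoped Matrix

namespace Summit.QuantumFields.YangMills.Theorems.CurvatureKernel

open Literature.Probability.LatticeModels Literature.MathematicalPhysics.QuantumLattice
  Literature.MathematicalPhysics.QuantumFieldTheory
  Summit.QuantumFields.YangMills.Cruxes.SourcedPressureIncrement.Birth

variable {d : ℕ}

/-! ### Square-summable rows without decay estimates -/

/-- Positivity of the one-orientation form, `Finset` version (from the family version
`sum_sum_mul_mul_curvatureTwoPoint_parallel_nonneg`). [folklore] -/
theorem sum_sum_curvatureTwoPoint_parallel_finset_nonneg (hd : 3 ≤ d) (P : {p : Fin d × Fin d // p.1 < p.2})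
    (S : Finset (Literature.Probability.LatticeModels.Site d)) (c : Literature.Probability.LatticeModels.Site d → ℝ) :
    0 ≤ ∑ x ∈ S, ∑ y ∈ S, c x * c y * curvatureTwoPoint ((x, P) : ZdPlaquette d) (y, P) := by
  have h := sum_sum_mul_mul_curvatureTwoPoint_parallel_nonneg hd P (J := S)
    (g := fun x : S => (x : Literature.Probability.LatticeModels.Site d)) (fun x => c x)
  have e1 : ∑ x ∈ S, ∑ y ∈ S, c x * c y * curvatureTwoPoint ((x, P) : ZdPlaquette d) (y, P) =
      ∑ x : S, ∑ y : S, c x * c y * curvatureTwoPoint (((x : Literature.Probability.LatticeModels.Site d), P) :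
        ZdPlaquette d) ((y : Literature.Probability.LatticeModels.Site d), P) := by
    rw [← Finset.sum_coe_sort S]
    exact Finset.sum_congr rfl fun x _ => (Finset.sum_coe_sort S _).symm
  rw [e1]
  exact h

/-- **Every row of the one-orientation kernel is square-summable, with the diagonal as bound**:
`∑_{y ∈ S} K((x;P),(y;P))² ≤ K((x;P),(x;P))` for every finite set `S` of sites — from `0 ≤ K ≤ 1` on the
orientation (`(K²)ₓₓ ≤ Kₓₓ`): expand `0 ≤ Q(δₓ - v)` for `v = K((x;P),(·;P))` on `insert x S` and use
`Q(v) ≤ ∑ v²`.  No decay estimate of the Green function is used. [folklore] -/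
theorem sum_sq_curvatureTwoPoint_parallel_le (hd : 3 ≤ d) (P : {p : Fin d × Fin d // p.1 < p.2})
    (x : Literature.Probability.LatticeModels.Site d) (S : Finset (Literature.Probability.LatticeModels.Site d)) :
    ∑ y ∈ S, curvatureTwoPoint ((x, P) : ZdPlaquette d) (y, P) ^ 2 ≤
      curvatureTwoPoint ((x, P) : ZdPlaquette d) (x, P) := by
  classical
  set T : Finset (Literature.Probability.LatticeModels.Site d) := insert x S with hT
  set v : Literature.Probability.LatticeModels.Site d → ℝ := fun y => curvatureTwoPoint ((x, P) : ZdPlaquette d) (y, P)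
    with hv
  have hxT : x ∈ T := Finset.mem_insert_self x S
  have hST : S ⊆ T := Finset.subset_insert x S
  have h0 := sum_sum_curvatureTwoPoint_parallel_finset_nonneg hd P T (fun y => (if y = x then 1 else 0) - v y)
  have h1 := sum_sum_curvatureTwoPoint_parallel_le_sum_sq hd P T v
  have hsymm : ∀ y : Literature.Probability.LatticeModels.Site d,
      curvatureTwoPoint ((y, P) : ZdPlaquette d) (x, P) = v y := fun y => curvatureTwoPoint_comm _ _
  have s1 : ∑ y ∈ T, ∑ y' ∈ T, (if y = x then (1 : ℝ) else 0) * (if y' = x then (1 : ℝ) else 0) *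
      curvatureTwoPoint ((y, P) : ZdPlaquette d) (y', P) = v x := by
    rw [Finset.sum_eq_single_of_mem x hxT (fun y _ hy => by simp [hy])]
    rw [Finset.sum_eq_single_of_mem x hxT (fun y' _ hy' => by simp [hy'])]
    simp [hv]
  have s2 : ∑ y ∈ T, ∑ y' ∈ T, (if y = x then (1 : ℝ) else 0) * v y' *
      curvatureTwoPoint ((y, P) : ZdPlaquette d) (y', P) = ∑ y' ∈ T, v y' ^ 2 := by
    rw [Finset.sum_eq_single_of_mem x hxT (fun y _ hy => by simp [hy])]
    exact Finset.sum_congr rfl fun y' _ => by simp [hv, sq]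
  have s3 : ∑ y ∈ T, ∑ y' ∈ T, v y * (if y' = x then (1 : ℝ) else 0) *
      curvatureTwoPoint ((y, P) : ZdPlaquette d) (y', P) = ∑ y ∈ T, v y ^ 2 := by
    refine Finset.sum_congr rfl fun y _ => ?_
    rw [Finset.sum_eq_single_of_mem x hxT (fun y' _ hy' => by simp [hy'])]
    rw [hsymm y]
    simp [sq]
  have hsplit : ∑ y ∈ T, ∑ y' ∈ T, ((if y = x then (1 : ℝ) else 0) - v y) * ((if y' = x then (1 : ℝ) else 0) - v y') *
        curvatureTwoPoint ((y, P) : ZdPlaquette d) (y', P) =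
      (∑ y ∈ T, ∑ y' ∈ T, (if y = x then (1 : ℝ) else 0) * (if y' = x then (1 : ℝ) else 0) *
          curvatureTwoPoint ((y, P) : ZdPlaquette d) (y', P)) -
        (∑ y ∈ T, ∑ y' ∈ T, (if y = x then (1 : ℝ) else 0) * v y' *
          curvatureTwoPoint ((y, P) : ZdPlaquette d) (y', P)) -
        (∑ y ∈ T, ∑ y' ∈ T, v y * (if y' = x then (1 : ℝ) else 0) *
          curvatureTwoPoint ((y, P) : ZdPlaquette d) (y', P)) +
        ∑ y ∈ T, ∑ y' ∈ T, v y * v y' * curvatureTwoPoint ((y, P) : ZdPlaquette d) (y', P) := by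
    simp only [← Finset.sum_sub_distrib, ← Finset.sum_add_distrib]
    exact Finset.sum_congr rfl fun y _ => Finset.sum_congr rfl fun y' _ => by ring
  rw [hsplit, s1, s2, s3] at h0
  have hA : ∑ y ∈ S, v y ^ 2 ≤ ∑ y ∈ T, v y ^ 2 :=
    Finset.sum_le_sum_of_subset_of_nonneg hST fun _ _ _ => sq_nonneg _
  show ∑ y ∈ S, v y ^ 2 ≤ v x
  linarith

/-- `∑_{y ∈ S} K((x;P),(y;P))² ≤ 2/d` (the diagonal value `curvatureTwoPoint_self`). [folklore] -/
theorem sum_sq_curvatureTwoPoint_parallel_le_two_div (hd : 3 ≤ d) (P : {p : Fin d × Fin d // p.1 < p.2})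
    (x : Literature.Probability.LatticeModels.Site d) (S : Finset (Literature.Probability.LatticeModels.Site d)) :
    ∑ y ∈ S, curvatureTwoPoint ((x, P) : ZdPlaquette d) (y, P) ^ 2 ≤ 2 / d :=
  (sum_sq_curvatureTwoPoint_parallel_le hd P x S).trans (le_of_eq (curvatureTwoPoint_self hd _))

/-- `(1,2)`-plane form: `∑_{y ∈ S} K(p₁₂(x), p₁₂(y))² ≤ 2/d`. [folklore] -/
theorem sum_sq_curvatureTwoPoint_plaquette12_le (hd : 3 ≤ d) (x : Literature.Probability.LatticeModels.Site d)
    (S : Finset (Literature.Probability.LatticeModels.Site d)) :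
    ∑ y ∈ S, curvatureTwoPoint (plaquette12 hd x) (plaquette12 hd y) ^ 2 ≤ 2 / d :=
  sum_sq_curvatureTwoPoint_parallel_le_two_div hd _ x S

/-- **The axis two-point numbers are square-summable**: `∑_{n ∈ T} c_n² ≤ 2/d` for every finite `T ⊂ ℤ`,
`c_n = curvaturePlaquetteCorr` (`2/d = 1/2` in `d = 4`; the decay `c_n = O(|n|^{-d})` is not used). [folklore] -/
theorem sum_sq_curvaturePlaquetteCorr_le (hd : 3 ≤ d) (T : Finset ℤ) :
    ∑ n ∈ T, curvaturePlaquetteCorr hd n ^ 2 ≤ 2 / d := by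
  classical
  have hinj : Function.Injective fun n : ℤ =>
      (Pi.single (⟨0, by omega⟩ : Fin d) n : Literature.Probability.LatticeModels.Site d) :=
    Pi.single_injective (M := fun _ : Fin d => ℤ) (⟨0, by omega⟩ : Fin d)
  have h := sum_sq_curvatureTwoPoint_plaquette12_le hd 0
    (T.image fun n : ℤ => (Pi.single (⟨0, by omega⟩ : Fin d) n : Literature.Probability.LatticeModels.Site d))
  rw [Finset.sum_image fun n _ m _ hnm => hinj hnm] at h
  exact h

/-! ### The coloured kernel: Gram matrices of one orientation are bounded by the identity -/

/-- **`xᵀ G x ≤ xᵀ x` for every Gram matrix `G = covGram (curvatureCovKernel d D) I` over a finite set `I` of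
(plaquette, colour) indices of ONE orientation** (`d ≥ 3`) — the matrix-API form of
`sum_sum_curvatureCovKernel_parallel_le_sum_sq`: the covariance matrices of the one-orientation finite-dimensional
marginals of `curvatureGaussianField d D` are bounded by the identity, uniformly in `I`. [folklore] -/
theorem dotProduct_covGram_curvatureCovKernel_mulVec_le (hd : 3 ≤ d) (D : ℕ)
    (P : {p : Fin d × Fin d // p.1 < p.2}) (I : Finset (ZdPlaquette d × Fin D))
    (hI : ∀ s ∈ I, s.1.2 = P) (x : I → ℝ) :
    x ⬝ᵥ (covGram (curvatureCovKernel d D) I *ᵥ x) ≤ x ⬝ᵥ x := by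
  have hQ : x ⬝ᵥ (covGram (curvatureCovKernel d D) I *ᵥ x) =
      ∑ s : I, ∑ t : I, x s * x t * curvatureCovKernel d D s t := by
    simp only [dotProduct, Matrix.mulVec, covGram_apply, Finset.mul_sum]
    exact Finset.sum_congr rfl fun s _ => Finset.sum_congr rfl fun t _ => by ring
  have hxx : x ⬝ᵥ x = ∑ s : I, x s ^ 2 := by
    simp only [dotProduct, sq]
  rw [hQ, hxx]
  exact sum_sum_curvatureCovKernel_parallel_le_sum_sq hd D P I hI x

/-- **`0 ≤ covGram ≤ 1` along one orientation**: together with `isPosSemidefKernel_curvatureCovKernel` (`0 ≤ G`),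
the Gram matrices of the coloured curvature kernel over (plaquette, colour) indices of one orientation satisfy
`1 - G ⪰ 0`. [folklore] -/
theorem posSemidef_one_sub_covGram_curvatureCovKernel (hd : 3 ≤ d) (D : ℕ)
    (P : {p : Fin d × Fin d // p.1 < p.2}) (I : Finset (ZdPlaquette d × Fin D))
    (hI : ∀ s ∈ I, s.1.2 = P) :
    (1 - covGram (curvatureCovKernel d D) I).PosSemidef := by
  refine Matrix.PosSemidef.of_dotProduct_mulVec_nonneg ?_ fun x => ?_
  · refine Matrix.IsHermitian.sub Matrix.isHermitian_one (Matrix.IsHermitian.ext fun s t => ?_)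
    simp only [covGram_apply, star_trivial]
    exact curvatureCovKernel_comm D _ _
  · rw [star_trivial, Matrix.sub_mulVec, Matrix.one_mulVec, dotProduct_sub, sub_nonneg]
    exact dotProduct_covGram_curvatureCovKernel_mulVec_le hd D P I hI x

/-- The two-sided Loewner sandwich in one statement: `0 ⪯ covGram (curvatureCovKernel d D) I ⪯ 1` for index sets of
one orientation. [folklore] -/
theorem covGram_curvatureCovKernel_posSemidef_and_le_one (hd : 3 ≤ d) (D : ℕ)
    (P : {p : Fin d × Fin d // p.1 < p.2}) (I : Finset (ZdPlaquette d × Fin D))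
    (hI : ∀ s ∈ I, s.1.2 = P) :
    (covGram (curvatureCovKernel d D) I).PosSemidef ∧ (1 - covGram (curvatureCovKernel d D) I).PosSemidef :=
  ⟨isPosSemidefKernel_curvatureCovKernel hd D I, posSemidef_one_sub_covGram_curvatureCovKernel hd D P I hI⟩

end Summit.QuantumFields.YangMills.Theorems.CurvatureKernel
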